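import Summits.HodgeConjecture.CorCM.Census.TwistGenerationLaw
import Summits.HodgeConjecture.CorCM.Census.CoinvariantTwistLaw

/-!
# Uniform twist generation, IX: THE EXACT LAW — `μ_hodge(ℤ/2^{j+1} × B, (2^j, 0)) = β − 1` for every `j ≥ 1` and every `B` without screw,
# `β − 2 ≤ μ ≤ β − 1` otherwise

COR-CM (cell `pub-hodgecm2`), count-neutral kernel combinatorics by the binder seat b09 (gen 36; lane UNIFORM TWIST GENERATION, part IX), on part VIII
(`exists_gfaces_generate`) and the treeʼs twist floor (`Census/CoinvariantTwistLaw.card_block_le_card_add_one/_two`, b09 gen 33) used BY NAME.  Theorems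
only: no definition, no `decide`, no certificate, no named fact, no `sorry`.
HONEST FRAMING: `HC_CM` is NOT proved, here or anywhere in the tree; nothing here is a period or a headline.

* §1 **the bridge** from a datum `θ : G ≃ ℤ/2n × B` to the `(u, B)` presentation of `Census/CoinvariantTwist*`: `u = θ⁻¹(1, 0)` is central of order `2n`,
  the subgroup `θ⁻¹(0 × B) ≤ G` (`exists_bSub`) meets `⟨u⟩` trivially, `G = ⟨u⟩·θ⁻¹(0 × B)`, `u^n = c`, and orders in `bSub` are the additive orders in `B`.
* §2 **THE EXACT LAW** for `n = 2^j` (`j ≥ 1`, `|B| ≥ 3`): if no element of `B` has additive order divisible by `2n` then the least number of rank-four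
  face relations whose base changes generate the Hodge lattice modulo pairs is EXACTLY `β − 1` (`exact_law_noScrew`: a family of `β − 1` faces exists, and
  no finite family of HODGE vectors of fewer than `β − 1` members generates); if some element has such order, `β − 2 ≤ μ ≤ β − 1` (`sandwich_screw`).
  This is gen 32ʼs GRAND CONJECTURE `μ = β − 1 − [∃ t ∈ B, 2^{j+1} ∣ ord t]` for ALL levels `j` in the no-screw case (kernel before: `j ≤ 2`), and up
  to the screw saving in general.

## References
* [Pohlmann1968] H. Pohlmann, Algebraic cycles on abelian varieties of complex multiplication type, Ann. of Math. 88 (1968), Thm 1.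
* [Milne1999] J. S. Milne, Lefschetz motives and the Tate conjecture, Compositio Math. 117 (1999), Prop. 2.1, p. 54.
-/

namespace Summit.HodgeConjecture.CorCM.Census.TwistGeneration

open Finset
open Summit.HodgeConjecture.CorCM.Prior.AllgGroup.RfwfAllgGroup
open Summit.HodgeConjecture.CorCM.Census.BlockParity
open Summit.HodgeConjecture.CorCM.Census.Coinvariant
open Summit.HodgeConjecture.CorCM.Census.CoinvariantTwist

noncomputable section

variable {G : Type*} [Group G] [Fintype G] [DecidableEq G] {c : G}
variable {B : Type} [AddGroup B]
variable {n : ℕ} [NeZero n] (θ : G ≃ ZMod (2 * n) × B)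

/-! ## §1 The bridge to the `(u, B)` presentation -/

section Bridge

omit [Fintype G] [DecidableEq G] [NeZero n] in
/-- A datum sends powers to multiples: `θ (g^k) = k • θ g`. [folklore] -/
theorem map_pow_eq (hθ : ∀ P Q : G, θ (P * Q) = θ P + θ Q) (g : G) (k : ℕ) : θ (g ^ k) = k • θ g := by
  induction k with
  | zero => rw [pow_zero, zero_smul, map_one_eq θ hθ]
  | succ k ih => rw [pow_succ, hθ, ih, succ_nsmul]

omit [Fintype G] [DecidableEq G] [NeZero n] in
/-- Powers of `u = θ⁻¹(1, 0)`: `u^k = θ⁻¹(k, 0)`. [folklore] -/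
theorem u_pow (hθ : ∀ P Q : G, θ (P * Q) = θ P + θ Q) (k : ℕ) : θ.symm (1, 0) ^ k = θ.symm ((k : ℕ), 0) :=
  θ.injective (by
    rw [map_pow_eq θ hθ, Equiv.apply_symm_apply, Equiv.apply_symm_apply, Prod.smul_mk, smul_zero, nsmul_eq_mul, mul_one])

omit [Fintype G] [DecidableEq G] [NeZero n] in
/-- **The complement `θ⁻¹(0 × B)` is a subgroup of `G`.** [folklore] -/
theorem exists_bSub (hθ : ∀ P Q : G, θ (P * Q) = θ P + θ Q) : ∃ Bs : Subgroup G, ∀ g : G, g ∈ Bs ↔ (θ g).1 = 0 :=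
  ⟨{ carrier := {g | (θ g).1 = 0}
     mul_mem' := fun {a b} ha hb => by
       change (θ (a * b)).1 = 0
       rw [hθ, Prod.fst_add, show (θ a).1 = 0 from ha, show (θ b).1 = 0 from hb, add_zero]
     one_mem' := by change (θ 1).1 = 0; rw [map_one_eq θ hθ]; rfl
     inv_mem' := fun {a} ha => by
       change (θ a⁻¹).1 = 0
       rw [map_inv_eq θ hθ, Prod.fst_neg, show (θ a).1 = 0 from ha, neg_zero] }, fun _ => Iff.rfl⟩

omit [Fintype G] [DecidableEq G] [NeZero n] in
/-- `u` is central. [folklore] -/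
theorem u_comm (hθ : ∀ P Q : G, θ (P * Q) = θ P + θ Q) (x : G) : x * θ.symm (1, 0) = θ.symm (1, 0) * x :=
  θ.injective (by
    rw [hθ, hθ, Equiv.apply_symm_apply]
    exact Prod.ext (add_comm _ _) (by simp only [Prod.snd_add, add_zero, zero_add]))

omit [Fintype G] [DecidableEq G] in
/-- `u` has order `2n`. [folklore] -/
theorem orderOf_u (hθ : ∀ P Q : G, θ (P * Q) = θ P + θ Q) : orderOf (θ.symm (1, 0) : G) = 2 * n := by
  have h2n : 0 < 2 * n := by have := NeZero.ne n; omega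
  have key : ∀ k : ℕ, (θ.symm (1, 0) : G) ^ k = 1 ↔ 2 * n ∣ k := by
    intro k
    rw [u_pow θ hθ, Equiv.symm_apply_eq, map_one_eq θ hθ, Prod.mk_eq_zero, ZMod.natCast_eq_zero_iff]
    exact ⟨fun h => h.1, fun h => ⟨h, rfl⟩⟩
  refine (orderOf_eq_iff h2n).mpr ⟨(key _).mpr dvd_rfl, fun m hm hm0 h => ?_⟩
  have := Nat.le_of_dvd hm0 ((key m).mp h)
  omega

omit [Fintype G] [DecidableEq G] [NeZero n] in
/-- `⟨u⟩ ∩ bSub = 1`. [folklore] -/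
theorem zpowers_u_disjoint (hθ : ∀ P Q : G, θ (P * Q) = θ P + θ Q) {Bs : Subgroup G} (hBs : ∀ g : G, g ∈ Bs ↔ (θ g).1 = 0)
    (g : G) (hg : g ∈ Subgroup.zpowers (θ.symm (1, 0) : G)) (hg' : g ∈ Bs) : g = 1 := by
  -- every element of `⟨u⟩` has second coordinate `0`
  let H : Subgroup G :=
    { carrier := {g | (θ g).2 = 0}
      mul_mem' := fun {a b} ha hb => by
        change (θ (a * b)).2 = 0
        rw [hθ, Prod.snd_add, show (θ a).2 = 0 from ha, show (θ b).2 = 0 from hb, add_zero]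
      one_mem' := by change (θ 1).2 = 0; rw [map_one_eq θ hθ]; rfl
      inv_mem' := fun {a} ha => by
        change (θ a⁻¹).2 = 0
        rw [map_inv_eq θ hθ, Prod.snd_neg, show (θ a).2 = 0 from ha, neg_zero] }
  have hle : Subgroup.zpowers (θ.symm (1, 0) : G) ≤ H := by
    rw [Subgroup.zpowers_le]
    change (θ (θ.symm (1, 0))).2 = 0
    rw [Equiv.apply_symm_apply]
  have h2 : (θ g).2 = 0 := hle hg
  have h1 : (θ g).1 = 0 := (hBs g).mp hg'
  exact θ.injective (by rw [map_one_eq θ hθ]; exact Prod.ext h1 h2)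

omit [Fintype G] [DecidableEq G] in
/-- `G = ⟨u⟩·bSub`. [folklore] -/
theorem exists_u_pow_mul (hθ : ∀ P Q : G, θ (P * Q) = θ P + θ Q) {Bs : Subgroup G} (hBs : ∀ g : G, g ∈ Bs ↔ (θ g).1 = 0) (g : G) :
    ∃ i : ℕ, ∃ b ∈ Bs, g = θ.symm (1, 0) ^ i * b := by
  refine ⟨(θ g).1.val, θ.symm (0, (θ g).2), by rw [hBs, Equiv.apply_symm_apply], θ.injective ?_⟩
  rw [hθ, u_pow θ hθ, Equiv.apply_symm_apply, Equiv.apply_symm_apply, Prod.mk_add_mk, ZMod.natCast_zmod_val, add_zero, zero_add]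

omit [Fintype G] [DecidableEq G] [NeZero n] in
/-- `u^n = c`. [folklore] -/
theorem u_pow_n (hθ : ∀ P Q : G, θ (P * Q) = θ P + θ Q) (hθc : θ c = (((n : ℕ) : ZMod (2 * n)), 0)) : θ.symm (1, 0) ^ n = c := by
  rw [u_pow θ hθ, ← hθc, Equiv.symm_apply_apply]

omit [Fintype G] [DecidableEq G] [NeZero n] in
/-- Orders in the complement are the additive orders in `B`. [folklore] -/
theorem orderOf_eq_addOrderOf (hθ : ∀ P Q : G, θ (P * Q) = θ P + θ Q) {g : G} (h1 : (θ g).1 = 0) : orderOf g = addOrderOf (θ g).2 := by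
  have hpow : ∀ k : ℕ, g ^ k = 1 ↔ k • (θ g).2 = 0 := by
    intro k
    rw [← θ.injective.eq_iff, map_pow_eq θ hθ, map_one_eq θ hθ, Prod.ext_iff, Prod.smul_fst, Prod.smul_snd, h1, smul_zero]
    exact ⟨fun h => h.2, fun h => ⟨rfl, h⟩⟩
  apply Nat.dvd_antisymm
  · exact orderOf_dvd_of_pow_eq_one ((hpow _).mpr (addOrderOf_nsmul_eq_zero _))
  · exact addOrderOf_dvd_of_nsmul_eq_zero ((hpow _).mp (pow_orderOf_eq_one g))

end Bridge

/-! ## §2 The exact law at the levels `n = 2^j` -/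

section Exact

variable [DecidableEq B] [Fintype B]
variable (hθ : ∀ P Q : G, θ (P * Q) = θ P + θ Q) (hθc : θ c = (((n : ℕ) : ZMod (2 * n)), 0))

include θ hθ hθc in
/-- **THE EXACT LAW, NO SCREW.**  `n = 2^j ≥ 2`, `|B| ≥ 3`, no element of `B` of additive order divisible by `2n`: there is a family of rank-four face
relations with EXACTLY `β − 1` members whose base changes generate the Hodge lattice modulo pairs, and every finite family of integer Hodge vectors whose
base changes generate the face relations modulo pairs has at least `β − 1` members: **`μ(G, c) = β(G, c) − 1`**. [folklore] -/
theorem exact_law_noScrew (hc2 : c * c = 1) {j : ℕ} (hj : n = 2 ^ j) (hn : 2 ≤ n) (hB : 3 ≤ Fintype.card B)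
    (hns : ∀ b : B, ¬ 2 * n ∣ addOrderOf b) :
    (∃ S : Finset (CMF G c →₀ ℤ), (↑S ⊆ gfaceSet G c hc2) ∧ S.card + 1 = Fintype.card (Block c) ∧
        hodgeSpan c hc2 ≤ Submodule.span ℤ (pairSet c) ⊔ Submodule.span ℤ (translates c S)) ∧
      (∀ S : Finset (CMF G c →₀ ℤ), (↑S : Set (CMF G c →₀ ℤ)) ⊆ hodgeSpan c hc2 →
        gfaceSet G c hc2 ⊆ ↑(Submodule.span ℤ (pairSet c) ⊔ Submodule.span ℤ (translates c S)) → Fintype.card (Block c) ≤ S.card + 1) := by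
  have hcu := u_pow_n θ hθ hθc
  obtain ⟨Bs, hBs⟩ := exists_bSub θ hθ
  subst hj
  have hfloor : ∀ S : Finset (CMF G c →₀ ℤ), (↑S : Set (CMF G c →₀ ℤ)) ⊆ hodgeSpan c hc2 →
      gfaceSet G c hc2 ⊆ ↑(Submodule.span ℤ (pairSet c) ⊔ Submodule.span ℤ (translates c S)) → Fintype.card (Block c) ≤ S.card + 1 := by
    subst hcu
    intro S hS hX
    exact card_block_le_card_add_one (B := Bs) (u_comm θ hθ) (by rw [orderOf_u θ hθ, pow_succ, mul_comm]) (zpowers_u_disjoint θ hθ hBs)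
      (exists_u_pow_mul θ hθ hBs) hc2
      (fun b hb h => hns (θ b).2 (by rw [← orderOf_eq_addOrderOf θ hθ ((hBs b).mp hb)]; rw [pow_succ, mul_comm] at h; exact h))
      S _ le_rfl hS hX
  refine ⟨?_, hfloor⟩
  obtain ⟨S, hS, hcard, hgen⟩ := exists_gfaces_generate θ hθ hθc hc2 hn hB
  have h := hfloor S (hS.trans (gfaceSet_subset_hodgeSpan c hc2)) fun y hy => hgen (gfaceSet_subset_hodgeSpan c hc2 hy)
  exact ⟨S, hS, by omega, hgen⟩

include θ hθ hθc in
/-- **THE SANDWICH, SCREW CASE.**  `n = 2^j ≥ 2`, `|B| ≥ 3`, some element of `B` of additive order divisible by `2n`: a family of at most `β − 1` face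
relations generates, and every generating family of integer Hodge vectors has at least `β − 2` members: **`β − 2 ≤ μ(G, c) ≤ β − 1`** (the screw saving
`μ = β − 2` is a kernel theorem for `n = 2, 4` only). [folklore] -/
theorem sandwich_screw (hc2 : c * c = 1) {j : ℕ} (hj : n = 2 ^ j) (hn : 2 ≤ n) (hB : 3 ≤ Fintype.card B)
    (hs : ∃ b : B, 2 * n ∣ addOrderOf b) :
    (∃ S : Finset (CMF G c →₀ ℤ), (↑S ⊆ gfaceSet G c hc2) ∧ S.card + 1 ≤ Fintype.card (Block c) ∧
        hodgeSpan c hc2 ≤ Submodule.span ℤ (pairSet c) ⊔ Submodule.span ℤ (translates c S)) ∧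
      (∀ S : Finset (CMF G c →₀ ℤ), (↑S : Set (CMF G c →₀ ℤ)) ⊆ hodgeSpan c hc2 →
        gfaceSet G c hc2 ⊆ ↑(Submodule.span ℤ (pairSet c) ⊔ Submodule.span ℤ (translates c S)) → Fintype.card (Block c) ≤ S.card + 2) := by
  refine ⟨exists_gfaces_generate θ hθ hθc hc2 hn hB, ?_⟩
  have hcu := u_pow_n θ hθ hθc
  obtain ⟨Bs, hBs⟩ := exists_bSub θ hθ
  subst hj
  subst hcu
  intro S hS hX
  obtain ⟨b, hb⟩ := hs
  refine card_block_le_card_add_two (B := Bs) (u_comm θ hθ) (by rw [orderOf_u θ hθ, pow_succ, mul_comm]) (zpowers_u_disjoint θ hθ hBs)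
    (exists_u_pow_mul θ hθ hBs) hc2 ⟨θ.symm (0, b), by rw [hBs, Equiv.apply_symm_apply], ?_⟩ S _ le_rfl hS hX
  rw [orderOf_eq_addOrderOf θ hθ (by rw [Equiv.apply_symm_apply]), Equiv.apply_symm_apply, pow_succ, mul_comm]
  exact hb

end Exact

end

end Summit.HodgeConjecture.CorCM.Census.TwistGeneration
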